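import Summits.HodgeConjecture.HodgeConjecture.Theorems.Ring2ClassTargets
import Literature.AlgebraicGeometry.HodgeTheory.UnitaryTwoTwoPowersHodgeClasses
import Literature.AlgebraicGeometry.HodgeTheory.RibetTypeOnePowersHodgeClasses
import HarnessLib

/-!
# Ring 2 (cell topic `Summits/HodgeConjecture/Ring2/`; seat `lit`, gen 69, R46-C′): ALL POWERS OF THE SIMPLE TYPE IV(1,1) FOURFOLDS — the Hodge conjecture for every complex abelian variety isogenous to a power `Aⁿ` of a simple abelian fourfold with imaginary quadratic endomorphism algebra, GRANTED Markman's theorem for `A`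

HONEST FRAMING (cell `pub-hodge-ring2`, verbatim): research route conditional on HC_CM; not a corollary;
Q11.4-sentence-2 already refuted in dim ≥ 3. `HC_CM` does NOT occur in this file. Markman's theorem
(`Markman2025_weilClasses_algebraic_abelianFourfold`) is a HYPOTHESIS wherever it appears, never asserted.
Theorems only — no definition, no named fact, no `sorry`.

THE PRINT. B. Moonen, Yu. Zarhin, *Hodge classes and Tate classes on simple abelian fourfolds*, Duke Math. J. **77**
(1995), type IV(1,1): for a simple abelian fourfold `X` with `End⁰(X) = K` imaginary quadratic, either `K` acts with
multiplicities `(3,1)` and `B•(Xⁿ) = D•(Xⁿ)` for all `n` (Ribet 1983 Thm. 3: HC for all powers), or with multiplicities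
`(2,2)` and `B•(Xⁿ) = ⟨D, W_K⟩` — the Hodge conjecture for all powers of `X` follows from the algebraicity of the Weil
classes `W_K ⊂ B²(X)`.

THIS FILE (input: the Literature lane's UNCONDITIONAL `UnitaryTwoTwoPowersHodgeClasses`, lit g69 R46-C —
`AVSlots.hodgeConjectureFor_of_unitaryTwoTwo_of_weilClasses`: HC for every `B` with slots over a `(2,2)` fourfold `A`
granted only that the rational `(2,2)` Weil classes of `(A, φ)` are algebraic; tensor FFT for `SL₄` + polarization).
* §1 **`hodgeConjectureFor_of_isIsogenous_powSucc_of_unitaryTwoTwo_of_hodgeConjectureFor`** — UNCONDITIONAL RELATIVE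
  FORM: for a fourfold `A` with `φ ≫ φ = -d`, `finrank_ℚ End⁰(A) = 2`, multiplicities `(2,2)`, the Hodge conjecture for `A`
  ALONE implies the Hodge conjecture for every abelian variety isogenous to a power `A^{N+1}` (van Geemen Lemma 3.7 for
  the isogeny).
* §2 **`powersOfSimpleTypeIVOneOneFourfolds_hcOnClass_of_markman`** — MODULO MARKMAN: the class of all complex abelian
  varieties isogenous to a power of a SIMPLE fourfold with imaginary quadratic `End⁰` is `HC`-closed (`HCOnClass`);
  pointwise `hodgeConjectureFor_of_isIsogenous_powSucc_of_isSimple_typeIVOneOne_of_markman`. This is a class of abelian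
  varieties of unbounded dimension `4(N+1)` reached by the ring-2 inputs {Markman} alone.
* on path: `powersOfSimpleTypeIVOneOneFourfolds_hcOnClass_of_hodgeConjecture`.

WHAT IS NOT CLAIMED: Markman is never asserted; products of DIFFERENT type IV(1,1) fourfolds are not treated; no `HC_CM`.

## References
* [MoonenZarhin1995Duke] B. Moonen, Yu. Zarhin, Duke Math. J. 77 (1995), the type IV(1,1) row («HC for all powers»).
* [MoonenZarhin1999LowDim] B. Moonen, Yu. Zarhin, Math. Ann. 315 (1999), §2 (2.3), (2.5) (2).
* [Ribet1983] K. A. Ribet, Amer. J. Math. 105 (1983), Thm. 3.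
* [vanGeemen1994HodgeAV] B. van Geemen, LNM 1594 (1994), Lemma 3.7, Thm. 6.12.
* [Deligne2000] P. Deligne, *The Hodge conjecture* (Clay problem description, 2000), §1.
* [claim: Markman2025SurveySecant, status: under-review] E. Markman, arXiv:2509.23403, Thm. 1.2.
-/

noncomputable section

open CategoryTheory CategoryTheory.Limits

namespace Summit.HodgeConjecture.Ring2.TypeIVOneOnePowers

open Literature.AlgebraicGeometry.Motives (AbelianVariety)
open Literature.AlgebraicGeometry.Motives.AbelianVariety
open Literature.AlgebraicGeometry.HodgeTheory
open Literature.AlgebraicGeometry.Milne1999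
open Summit.HodgeConjecture.HodgeConjecture.Ring2.ClassTargets

/-! ### §1 The relative form: `HC(A) ⟹ HC(B)` for every `B` isogenous to a power of a `(2,2)` fourfold `A` -/

/-- **`HC(A)` implies `HC` for every abelian variety isogenous to a power `A^{N+1}`**, `A` a fourfold with
`φ ≫ φ = -d` (`d > 0`), `finrank_ℚ End⁰(A) = 2` and multiplicities `(2,2)` — UNCONDITIONAL (the Literature lane's
`AVSlots.hodgeConjectureFor_of_unitaryTwoTwo_of_hodgeConjectureFor` at the slots of `A^{N+1}`, and van Geemen's Lemma 3.7).
[cite: MoonenZarhin1995Duke, the type IV(1,1) row] [cite: vanGeemen1994HodgeAV, Lemma 3.7 and Thm. 6.12] -/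
theorem hodgeConjectureFor_of_isIsogenous_powSucc_of_unitaryTwoTwo_of_hodgeConjectureFor {A B : AbelianVariety ℂ}
    (φ : A ⟶ A) {d : ℕ} (hd : 0 < d) (hφ : φ ≫ φ = -(d • 𝟙 A)) (hE2 : Module.finrank ℚ A.endAlgebra = 2)
    (h2a : 2 ≤ eigenMultiplicity A φ (Complex.I * (Real.sqrt d : ℂ)))
    (h2b : 2 ≤ eigenMultiplicity A φ (-(Complex.I * (Real.sqrt d : ℂ)))) (hdim : A.dim = 4)
    (hA : HodgeConjectureFor A.dim A.X) {N : ℕ} (hB : B.IsIsogenous (A.powSucc N)) :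
    HodgeConjectureFor B.dim B.X :=
  HodgeConjectureFor.of_isIsogenous hB
    ((AVSlots.powSucc A N).hodgeConjectureFor_of_unitaryTwoTwo_of_hodgeConjectureFor φ hd hφ hE2 h2a h2b hdim hA)

/-- **`HC(A) ⟹ HC(B)` for every `B` isogenous to a power of a SIMPLE fourfold `A` of type IV(1,1)** (`(3,1)`: `B = D`
unconditionally and `HC(A)` is not even needed; `(2,2)`: the previous theorem). [cite: MoonenZarhin1995Duke, the type IV(1,1) row]
[cite: Ribet1983, Thm. 3] [cite: vanGeemen1994HodgeAV, Lemma 3.7] -/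
theorem hodgeConjectureFor_of_isIsogenous_powSucc_of_isSimple_typeIVOneOne_of_hodgeConjectureFor
    {A B : AbelianVariety ℂ} (hs : A.IsSimple) (φ : A ⟶ A) {d : ℕ} (hd : 0 < d) (hφ : φ ≫ φ = -(d • 𝟙 A))
    (hE2 : Module.finrank ℚ A.endAlgebra = 2) (hdim : A.dim = 4) (hA : HodgeConjectureFor A.dim A.X) {N : ℕ}
    (hB : B.IsIsogenous (A.powSucc N)) : HodgeConjectureFor B.dim B.X := by
  obtain ⟨ha, hb⟩ := AbelianVariety.eigenMultiplicity_pos_of_isSimple A hs φ hd hφ (by omega)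
  have hsum := eigenMultiplicity_add_eigenMultiplicity_neg_eq_dim A φ hd hφ
  by_cases h1 : eigenMultiplicity A φ (Complex.I * (Real.sqrt d : ℂ)) = 1 ∨
      eigenMultiplicity A φ (-(Complex.I * (Real.sqrt d : ℂ))) = 1
  · exact hodgeConjectureFor_of_isIsogenous_powSucc_of_ribetTypeOne φ hd hφ hE2 h1 (by omega) hB
  · push Not at h1
    exact hodgeConjectureFor_of_isIsogenous_powSucc_of_unitaryTwoTwo_of_hodgeConjectureFor φ hd hφ hE2 (by omega)
      (by omega) hdim hA hB

/-! ### §2 Modulo Markman: all powers of all simple type IV(1,1) fourfolds -/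

/-- **The Hodge conjecture for every complex abelian variety isogenous to a power of a simple abelian fourfold with
imaginary quadratic endomorphism algebra, GRANTED Markman's theorem** (hypothesis `hMark`).
[cite: MoonenZarhin1995Duke, the type IV(1,1) row] [cite: Ribet1983, Thm. 3] [claim: Markman2025SurveySecant, status: under-review] -/
theorem hodgeConjectureFor_of_isIsogenous_powSucc_of_isSimple_typeIVOneOne_of_markman
    (hMark : Markman2025_weilClasses_algebraic_abelianFourfold) {A B : AbelianVariety ℂ} (hs : A.IsSimple)
    (φ : A ⟶ A) {d : ℕ} (hd : 0 < d) (hφ : φ ≫ φ = -(d • 𝟙 A)) (hE2 : Module.finrank ℚ A.endAlgebra = 2)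
    (hdim : A.dim = 4) {N : ℕ} (hB : B.IsIsogenous (A.powSucc N)) : HodgeConjectureFor B.dim B.X :=
  hodgeConjectureFor_of_isIsogenous_powSucc_of_isSimple_typeIVOneOne_of_hodgeConjectureFor hs φ hd hφ hE2 hdim
    (hodgeConjectureFor_of_isSimple_fourfold_of_finrank_end_eq_two_of_markman hMark A hs φ hd hφ hE2 hdim) hB

/-- **The powers of the simple type IV(1,1) fourfolds form a CLOSED class target modulo Markman** (`HCOnClass`): every
complex abelian variety isogenous to some `A^{N+1}`, `A` a simple fourfold with `φ ≫ φ = -d`, `finrank_ℚ End⁰(A) = 2`.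
[cite: MoonenZarhin1995Duke, the type IV(1,1) row] [claim: Markman2025SurveySecant, status: under-review] -/
theorem powersOfSimpleTypeIVOneOneFourfolds_hcOnClass_of_markman
    (hMark : Markman2025_weilClasses_algebraic_abelianFourfold) :
    HCOnClass fun B => ∃ (A : AbelianVariety ℂ) (φ : A ⟶ A) (d N : ℕ), A.dim = 4 ∧ A.IsSimple ∧ 0 < d ∧
      φ ≫ φ = -(d • 𝟙 A) ∧ Module.finrank ℚ A.endAlgebra = 2 ∧ B.IsIsogenous (A.powSucc N) := by
  rintro B ⟨A, φ, d, N, hA4, hs, hd, hφ, hE2, hB⟩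
  exact hodgeConjectureFor_of_isIsogenous_powSucc_of_isSimple_typeIVOneOne_of_markman hMark hs φ hd hφ hE2 hA4 hB

/-- **On path**: the class is a case of the summit. [cite: Deligne2000, §1] -/
theorem powersOfSimpleTypeIVOneOneFourfolds_hcOnClass_of_hodgeConjecture (h : _root_.HodgeConjecture) :
    HCOnClass fun B => ∃ (A : AbelianVariety ℂ) (φ : A ⟶ A) (d N : ℕ), A.dim = 4 ∧ A.IsSimple ∧ 0 < d ∧
      φ ≫ φ = -(d • 𝟙 A) ∧ Module.finrank ℚ A.endAlgebra = 2 ∧ B.IsIsogenous (A.powSucc N) :=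
  hcOnClass_of_hodgeConjecture _ h

end Summit.HodgeConjecture.Ring2.TypeIVOneOnePowers

end
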